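import Summits.BirchSwinnertonDyer.Rank1Residual.X5.SelfDualRelaxedStrictCount
import Summits.BirchSwinnertonDyer.Rank1Residual.GaloisImage.PropagatedConditionCount
import Literature.NumberTheory.GaloisCohomology.PoitouTateSelmerStructuresRealPlaces
import HarnessLib

/-!
# The KUMMER structure is residually self-dual at EVERY place (real places included), and
# `[Sel^{(n)} relaxed at v₀ : Sel^{(n)} strict at v₀] = #E(K_{v₀})[n] · #(𝓞_{v₀}/n)`
# (cell `b2b-bsdres`; O1 PROVER ORDER v2.8 item (ii) "G3-T4", target form `a − b = 1 + e`
# (cells/o1/PLAN.md C69/C80; REFUTER-O1 §19 D5); sequel of `X5/SelfDualRelaxedStrictCount.lean`;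
# seat x11b3-p9 GEN 2/3, cross-cell pool work)

HONEST FRAMING (cell `b2b-bsdres`, run/shared/lean/b2b/bsd-rank1-residual/, verbatim in every file): the
goal of the cell is to DELETE the COMBINATION-SHAPED residual classes of the Birch–Swinnerton-Dyer
formula for ALL analytic-rank `≤ 1` elliptic curves over `ℚ` — "full BSD formula for every rank `≤ 1`
curve in class `C`" assembled STRICTLY from published theorems — so that the rank-`≤ 1` remainder
becomes exactly the CONSTRUCTION-SHAPED classes, which are TYPED (missing-input `Prop`s), NOT
attempted. This is not "finishing BSD". Team O1 (X5 at `p = 2`): research routes; O1 OPEN; nothing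
booked; no mark / label / count moved. THEOREMS ONLY: no definition, no named fact is minted, no
`sorry`. CONDITIONAL (hypotheses, exactly as the parent file): a family `inv` of local invariant maps
with the properties of the tree's named fact `poitouTate_selmerStructure_duality` (Howard 2004
Thm. 2.1.11, Milne ADT I Cor. 2.3 / Thm. 4.10), Tate's local Euler–Poincaré characteristic (named fact
`localEulerPoincareCharacteristic`, Milne ADT I Thm. 2.8), and at the REAL places of `K` the injectivity
of `inv_w` on `H²(K_w, μₙ) = Br(K_w)[n]` (true for the invariant maps of class field theory,
`Br(ℝ) = ½ℤ/ℤ`; NOT recorded by the tree's fact — the same extra binder as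
`Literature/…/CasselsTateLemma615LocalInputs.lean`; vacuous when `K` is totally complex).

## What this file proves

* `dualTransported_weilDual_eq_annRight` — Sakamoto's transported dual condition `w⁻¹(𝓛_v^*)` IS the
  right annihilator of `𝓛_v` under `inv_v(· ∪ₑ ·)` (`X11b.Relaxation.invWeilPairing`);
* **`annRight_invWeilPairing_kummerSelmerStructure_inl_of_injective`** /
  **`dualTransported_kummerSelmerStructure_inl_of_injective`** — NEW: at a REAL (any infinite) place
  `w` with `inv_w` injective, the local Kummer condition `𝓛_w = im(E(K_w)/n)` is its own right
  annihilator, i.e. the Kummer structure is residually self-dual at `w` (archimedean Tate duality for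
  `E[n]`, `eq_zero_of_forall_weilCupProduct_eq_zero_right_infinitePlace`, Milne I Thm. 2.13; isotropy,
  Poonen–Rains; count `#H¹(K_w, E[n]) ≤ (#𝓛_w)²`, Milne I Rem. 3.7, tree
  `natCard_galoisCohomology_one_torsion_le_sq_inl`) — the archimedean companion of
  `X11b.KummerDuality.annRight_invWeilPairing_kummerSelmerStructure_inr` (finite places) and of
  n1011-p18's `GaloisImage.dualTransported_kummerSelmerStructure_inr`; at COMPLEX places trivially
  (`dualTransported_inl_of_isComplex`, `H¹ = 0`);
* `dualTransported_kummerSelmerStructure_eq` — hence the Kummer structure on `E[n]` (`n` a prime power)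
  is residually self-dual at EVERY place of `K`;
* **`relIndex_kummer_update_bot_update_top_eq`** — THE KUMMER COUNT, for `n = p^k`, any number field
  `K`, any `E/K`, any finite `v₀` (the Weil pairing comes from the tree's PROVED
  `exists_weilPairing_holds`, the finite exceptional set from `X11b.KummerPT.exists_exceptional_finset`):
  `[Sel^{(n)} relaxed at v₀ : Sel^{(n)} strict at v₀] = #E(K_{v₀})[n] · #(𝓞_{v₀}/n)`
  (parent file §4 `relIndex_update_bot_update_top_eq_of_localEuler`).  At `K = ℚ`, `n = 2`, `v₀ = 2`:
  `[relaxed : strict] = 2 · #E(ℚ₂)[2]`, i.e. `a − b = 1 + e`, `e = dim_{𝔽₂} E(ℚ₂)[2]`;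
  `relIndex_kummer_update_bot_update_top_eq_two_mul_of_facts` — the same `inv`-free, CONDITIONAL on
  exactly the two cited named facts `poitouTate_selmerStructure_duality_real ℚ` (b2b-bsdres-lit GEN 53,
  p283639: the real-place clause `hreal` is now part of a cited fact — ASK L-G18.1 closed) and
  `localEulerPoincareCharacteristic`.

References: [MilneADT2006] I Cor. 2.3, Thm. 2.8, Thm. 2.13, Rem. 3.7, Cor. 3.4, Thm. 4.10, Lemma 6.15;
[Howard2004HeegnerKolyvagin] Thm. 2.1.11; [Sakamoto2024] §3.1.2, Def. 3.8–3.9; [PoonenRains2012]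
Prop. 4.10; [SilvermanAEC2009] III.8.1; [GreenbergLNM1716] §3.
-/

noncomputable section

open scoped Classical

universe u

open CategoryTheory Field Function NumberField IsDedekindDomain WeierstrassCurve
open Literature.NumberTheory.EllipticCurves
open Literature.NumberTheory.GaloisRepresentations
open Literature.NumberTheory.GaloisRepresentations.DiscreteGaloisModule (mu MuCarrier SelmerStructure
  localTatePairingZMod tateDual localMap)
open Literature.NumberTheory.GaloisCohomology
open Summit.BirchSwinnertonDyer.Rank1Residual.X11b.LocBridge
open Summit.BirchSwinnertonDyer.Rank1Residual.X11b.Levels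
open scoped ContRepresentation

namespace Summit.BirchSwinnertonDyer.Rank1Residual.X5.SelfDualCount

-- No local-instance attribute in this file: the finiteness of `E[n]` needed to STATE the
-- transported dual `w⁻¹(𝓛_v^*)` (§5) is the explicit instance binder `[Finite (geomTorsion W n)]`
-- (discharged by `finite_geomTorsion_of_neZero`, Silverman III.6.4, wherever `n` is concrete).

/-! ## §5. The Kummer structure: residual self-duality at EVERY place, and the count for `Sel^{(n)}` -/

section Kummer

variable {K : Type} [Field K] [NumberField K] (W : WeierstrassCurve K) (n : ℕ) [NeZero n]
  [W.IsElliptic] [Finite (geomTorsion W n)]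
variable (e : geomTorsion W n → geomTorsion W n → AlgebraicClosure K)
  (hμ : ∀ S T, e S T ^ n = 1)
  (hadd₁ : ∀ S₁ S₂ T, e (S₁ + S₂) T = e S₁ T * e S₂ T)
  (hadd₂ : ∀ S T₁ T₂, e S (T₁ + T₂) = e S T₁ * e S T₂)
  (hgal : ∀ (σ : absoluteGaloisGroup K) (S T : geomTorsion W n), σ • e S T = e (σ • S) (σ • T))
  (halt : ∀ T, e T T = 1) (hnondeg : ∀ T, (∀ S, e S T = 1) → T = 0)
  (inv : LocalInvariants K n)

omit [Finite (geomTorsion W n)] in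
/-- **Sakamoto's transported dual condition is the right annihilator under `inv_v(· ∪ₑ ·)`**:
`w⁻¹(𝓛_v^*) = 𝓛_v^⊥` for the `ℤ/n`-valued pairing `X11b.Relaxation.invWeilPairing … inv v` on
`H¹(K_v, E[n])` (unfolding `mem_dualTransported_weilDual_iff`, n1011-p18). [cite: Sakamoto2024, §3.1.2 (p. 924)] -/
theorem dualTransported_weilDual_eq_annRight (𝓛 : SelmerStructure (W.torsionGaloisModule n))
    (v : Place K) :
    inv.dualTransported 𝓛 (weilDualIntertwining W n e hμ hadd₁ hadd₂ hgal) v =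
      X11b.FiniteDuality.annRight (X11b.Relaxation.invWeilPairing W n e hμ hadd₁ hadd₂ hgal inv v) (𝓛 v) := by
  ext y
  rw [GaloisImage.mem_dualTransported_weilDual_iff, X11b.FiniteDuality.mem_annRight_iff]
  exact forall₂_congr fun a _ => by rw [X11b.Relaxation.invWeilPairing_apply]

include halt hnondeg in
omit [Finite (geomTorsion W n)] in
/-- **At a REAL (or any infinite) place `w` with `inv_w` injective on `H²(K_w, μₙ)`, the local Kummer
condition is its own RIGHT annihilator under `inv_w(· ∪ₑ ·)`** — the archimedean companion of
`X11b.KummerDuality.annRight_invWeilPairing_kummerSelmerStructure_inr`: isotropy (Poonen–Rains,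
`invWeilPairing_eq_zero_of_mem`), trivial right kernel of the Weil cup product on `H¹(K_w, E[n])`
(archimedean Tate duality for `E[n]`, `eq_zero_of_forall_weilCupProduct_eq_zero_right_infinitePlace`,
Milne I Thm. 2.13), and the count `#H¹(K_w, E[n]) ≤ (#𝓛_w)²` (Milne I Rem. 3.7, tree
`natCard_galoisCohomology_one_torsion_le_sq_inl`). The injectivity of `inv_w` holds for the invariant map
of class field theory (`Br(ℝ) = ½ℤ/ℤ`) but is NOT part of the tree's Poitou–Tate fact: a HYPOTHESIS.
[cite: MilneADT2006, Ch. I, Thm. 2.13, Rem. 3.7 and Lemma 6.15] [cite: PoonenRains2012, Prop. 4.10] -/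
theorem annRight_invWeilPairing_kummerSelmerStructure_inl_of_injective (w : InfinitePlace K)
    (hι : Injective (inv (Sum.inl w))) :
    X11b.FiniteDuality.annRight (X11b.Relaxation.invWeilPairing W n e hμ hadd₁ hadd₂ hgal inv (Sum.inl w))
        (W.kummerSelmerStructure n (Sum.inl w)) = W.kummerSelmerStructure n (Sum.inl w) := by
  set b := X11b.Relaxation.invWeilPairing W n e hμ hadd₁ hadd₂ hgal inv (Sum.inl w) with hb
  set L := W.kummerSelmerStructure n (Sum.inl w) with hL
  have hnZ : (n : ℤ) ≠ 0 := Int.natCast_ne_zero.mpr (NeZero.ne n)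
  haveI := finite_absoluteGaloisGroup_completion_infinitePlace w
  haveI : CharZero w.Completion :=
    charZero_of_injective_algebraMap (algebraMap K w.Completion).injective
  haveI hfinA : Finite (galoisCohomology ((W.torsionGaloisModule n).toLocal (Sum.inl w)) 1) :=
    W.finite_galoisCohomology_one_torsion_restrictField_of_finite w.Completion hnZ
  have hA : ∀ x : galoisCohomology ((W.torsionGaloisModule n).toLocal (Sum.inl w)) 1, n • x = 0 :=
    nsmul_continuousCohomology_one_eq_zero _ n (fun T : geomTorsion W n => AddSubgroup.torsionBy.nsmul T)
  haveI := finite_addMonoidHom_zmod (galoisCohomology ((W.torsionGaloisModule n).toLocal (Sum.inl w)) 1) n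
  -- isotropy: `L ≤ L^⊥`
  have hle : L ≤ X11b.FiniteDuality.annRight b L := fun y hy x hx =>
    X11b.Relaxation.invWeilPairing_eq_zero_of_mem W n e hμ hadd₁ hadd₂ hgal halt inv (Sum.inl w) hx hy
  -- the right adjoint is injective (archimedean Tate duality + `inv_w` injective), hence bijective
  have hflip : Bijective b.flip := by
    have hinj : Injective b.flip := by
      intro y y' h
      rw [← sub_eq_zero]
      refine eq_zero_of_forall_weilCupProduct_eq_zero_right_infinitePlace W n e hμ hadd₁ hadd₂ w hgal halt
        hnondeg _ fun x => ?_
      have h1 : b x (y - y') = 0 := by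
        rw [map_sub, sub_eq_zero]
        exact DFunLike.congr_fun h x
      rw [hb, X11b.Relaxation.invWeilPairing_apply] at h1
      exact hι (h1.trans (map_zero _).symm)
    exact hinj.bijective_of_nat_card_le (Nat.card_addMonoidHom_zmod hA).le
  -- counting: `#L^⊥ · #L = #H¹ ≤ #L · #L`
  have hNL : Nat.card (X11b.FiniteDuality.annRight b L) * Nat.card L =
      Nat.card (galoisCohomology ((W.torsionGaloisModule n).toLocal (Sum.inl w)) 1) :=
    X11b.FiniteDuality.natCard_annRight_mul hA b hflip L
  have hsq : Nat.card (galoisCohomology ((W.torsionGaloisModule n).toLocal (Sum.inl w)) 1) ≤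
      Nat.card L * Nat.card L :=
    W.natCard_galoisCohomology_one_torsion_le_sq_inl w hnZ
  have hLpos : 0 < Nat.card L := Nat.card_pos
  have hcard : Nat.card (X11b.FiniteDuality.annRight b L) ≤ Nat.card L :=
    Nat.le_of_mul_le_mul_right (hNL.trans_le hsq) hLpos
  exact (AddSubgroup.eq_of_le_of_card_ge hle hcard).symm

include halt hnondeg in
omit [Finite (geomTorsion W n)] in
/-- **The Kummer structure is residually self-dual at a REAL place `w` with `inv_w` injective**:
`w⁻¹(𝓚_w^*) = 𝓚_w` (so no real place is exceptional, Sakamoto Def. 3.9), the archimedean companion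
of n1011-p18's `dualTransported_kummerSelmerStructure_inr`. [cite: Sakamoto2024, Def. 3.9 (p. 924)]
[cite: MilneADT2006, Ch. I, Thm. 2.13 and Rem. 3.7] -/
theorem dualTransported_kummerSelmerStructure_inl_of_injective (w : InfinitePlace K)
    (hι : Injective (inv (Sum.inl w))) :
    inv.dualTransported (W.kummerSelmerStructure n) (weilDualIntertwining W n e hμ hadd₁ hadd₂ hgal)
        (Sum.inl w) = W.kummerSelmerStructure n (Sum.inl w) := by
  rw [dualTransported_weilDual_eq_annRight]
  exact annRight_invWeilPairing_kummerSelmerStructure_inl_of_injective W n e hμ hadd₁ hadd₂ hgal halt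
    hnondeg inv w hι

/-- At a COMPLEX place every local condition on `E[n]` equals its transported dual (both are subgroups
of `H¹(K_w, E[n]) = 0`; `X11b.LocBridge.eq_top_of_isComplex`). [cite: GreenbergLNM1716, §3 p. 87] -/
theorem dualTransported_inl_of_isComplex (𝓛 : SelmerStructure (W.torsionGaloisModule n))
    {w : InfinitePlace K} (hw : w.IsComplex) :
    inv.dualTransported 𝓛 (weilDualIntertwining W n e hμ hadd₁ hadd₂ hgal) (Sum.inl w) = 𝓛 (Sum.inl w) := by
  rw [eq_top_of_isComplex (W.torsionGaloisModule n) hw (𝓛 (Sum.inl w)),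
    eq_top_of_isComplex (W.torsionGaloisModule n) hw (inv.dualTransported 𝓛 _ (Sum.inl w))]

include halt hnondeg in
/-- **The Kummer structure on `E[n]` is residually self-dual at EVERY place** (`n` a prime power):
finite places by n1011-p18 (`dualTransported_kummerSelmerStructure_inr`: `inv_v` injective from
`IsPerfect`, Tate's local Euler characteristic `hEP`), complex places trivially, real places by
`dualTransported_kummerSelmerStructure_inl_of_injective` under the hypothesis `hreal`.
[cite: Sakamoto2024, Def. 3.9 (p. 924)] [cite: MilneADT2006, Ch. I, Cor. 3.4, Thm. 2.13 and Rem. 3.7] -/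
theorem dualTransported_kummerSelmerStructure_eq (hn : IsPrimePow n) (hperf : inv.IsPerfect)
    (hEP : ∀ v : HeightOneSpectrum (𝓞 K), localEulerPoincareCharacteristic (v.adicCompletion K))
    (hreal : ∀ w : InfinitePlace K, w.IsReal → Injective (inv (Sum.inl w))) (v : Place K) :
    inv.dualTransported (W.kummerSelmerStructure n) (weilDualIntertwining W n e hμ hadd₁ hadd₂ hgal) v =
      W.kummerSelmerStructure n v := by
  rcases v with w | v
  · rcases w.isReal_or_isComplex with hw | hw
    · exact dualTransported_kummerSelmerStructure_inl_of_injective W n e hμ hadd₁ hadd₂ hgal halt hnondeg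
        inv w (hreal w hw)
    · exact dualTransported_inl_of_isComplex W n e hμ hadd₁ hadd₂ hgal inv _ hw
  · exact GaloisImage.dualTransported_kummerSelmerStructure_inr W n e hμ hadd₁ hadd₂ hgal halt hnondeg hn
      v (hEP v) inv (hperf v).1.injective

end Kummer

section KummerCount

variable {K : Type} [Field K] [NumberField K] (W : WeierstrassCurve K) [W.IsElliptic] (n : ℕ) [NeZero n]

/-- **THE KUMMER COUNT: `[Sel^{(n)} relaxed at v₀ : Sel^{(n)} strict at v₀] = #E(K_{v₀})[n] · #(𝓞_{v₀}/n)`**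
for a prime power `n`, every number field `K`, every elliptic curve `E/K`, every FINITE place `v₀`,
and a family `inv` of local invariant maps with the three Poitou–Tate properties of the tree's named
fact `poitouTate_selmerStructure_duality K` (`IsPerfect`, `SumLocalTermEqZero`, `SelmerComplement`)
which is moreover injective at the REAL places (`hreal`: true for the invariant maps of class field
theory, `Br(ℝ) = ½ℤ/ℤ`, NOT recorded by the tree's fact — a HYPOTHESIS; vacuous for totally complex
`K`), GIVEN Tate's local Euler–Poincaré characteristic at the finite places (`hEP`, the named fact
`localEulerPoincareCharacteristic`, a HYPOTHESIS).  Here "relaxed/strict at `v₀`" are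
`Function.update 𝓚 v₀ ⊤/⊥` of the Kummer Selmer structure `𝓚 = kummerSelmerStructure` on `E[n]`
(whose Selmer group is `Sel^{(n)}(E/K)`, `selmerGroup_eq_selmerGroup_kummerSelmerStructure`; the
relaxed Selmer group is `kummerOutside W n {v₀}`, `X11b.KummerDuality.selmerGroup_update_top_eq_kummerOutside`),
and the right-hand side is the order of the local Kummer condition `#(E(K_{v₀})/n)` (Milne I Lemma 3.3).
Proof: parent file §4 for `𝓛 = 𝓚`, residually self-dual at every place (`dualTransported_kummerSelmerStructure_eq`)
for the Weil pairing of the tree's PROVED `exists_weilPairing_holds` (Silverman III.8.1), on a finite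
exceptional set `S ⊇ ∞ ∪ {v ∣ p} ∪ {bad} ∪ {v₀}` (`n = p^k`; `X11b.KummerPT.exists_exceptional_finset`,
`X11b.KummerDuality.kummerSelmerStructure_isUnramifiedOutside`, `X11b.AcSelmer.isUnramifiedAt_torsionGaloisModule`).
At `K = ℚ`, `n = 2`, `v₀ = 2`: `[relaxed : strict] = 2 · #E(ℚ₂)[2]`, i.e. REFUTER-O1 §19 D5's
`a − b = 1 + e` (O1 PROVER ORDER v2.8 item (ii) G3-T4).  CONDITIONAL on the stated hypotheses; nothing
booked; O1 OPEN. [cite: MilneADT2006, Ch. I, Thm. 2.8, Cor. 3.4, Thm. 4.10 and Lemma 6.15]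
[cite: Howard2004HeegnerKolyvagin, Thm. 2.1.11 (arXiv:1202.6340 p. 6)] [cite: Sakamoto2024, §3.1.2 (p. 924)]
[cite: SilvermanAEC2009, Prop. III.8.1] -/
theorem relIndex_kummer_update_bot_update_top_eq (hn : IsPrimePow n) (inv : LocalInvariants K n)
    (hperf : inv.IsPerfect) (hvan : inv.SumLocalTermEqZero) (hcomp : inv.SelmerComplement)
    (hEP : ∀ v : HeightOneSpectrum (𝓞 K), localEulerPoincareCharacteristic (v.adicCompletion K))
    (hreal : ∀ w : InfinitePlace K, w.IsReal → Injective (inv (Sum.inl w)))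
    (w₀ : HeightOneSpectrum (𝓞 K)) :
    (SelmerStructure.selmerGroup (Function.update (W.kummerSelmerStructure (n : ℤ))
          (Sum.inr w₀) ⊥ : SelmerStructure (W.torsionGaloisModule (n : ℤ)))).relIndex
        (SelmerStructure.selmerGroup (Function.update (W.kummerSelmerStructure (n : ℤ))
          (Sum.inr w₀) ⊤ : SelmerStructure (W.torsionGaloisModule (n : ℤ)))) =
      Nat.card (nsmulAddMonoidHom n : (W.baseChange (w₀.adicCompletion K)).toAffine.Point →+ _).ker *
        Nat.card (w₀.adicCompletionIntegers K ⧸ Ideal.span {(n : w₀.adicCompletionIntegers K)}) := by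
  -- `n = p^k`, `p` prime, `k ≥ 1`
  obtain ⟨p, k, hp, hk, rfl⟩ := (isPrimePow_nat_iff n).mp hn
  haveI : Fact p.Prime := ⟨hp⟩
  haveI := finite_geomTorsion_of_neZero W (p ^ k)
  -- a Weil pairing on `E[p^k]` (PROVED in the tree: `exists_weilPairing_holds`, Silverman III.8.1)
  obtain ⟨e, hμ, hadd₁, hadd₂, halt, hnondeg, hgal⟩ := exists_weilPairing_holds W (p ^ k)
    (hp.two_le.trans (Nat.le_self_pow hk.ne' p)) (Nat.cast_ne_zero.mpr (NeZero.ne (p ^ k)))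
  -- a finite exceptional set `S ⊇ {v₀} ∪ ∞ ∪ {v ∣ p} ∪ {bad}`
  obtain ⟨S, hv₀S, hinf, hpS, hbad⟩ := X11b.KummerPT.exists_exceptional_finset W p {(Sum.inr w₀ : Place K)}
  have hw₀ : (Sum.inr w₀ : Place K) ∈ S := hv₀S (Finset.mem_singleton_self _)
  have hS : ∀ v : HeightOneSpectrum (𝓞 K), (Sum.inr v : Place K) ∉ S →
      (((p ^ k : ℕ) : ℕ) : 𝓞 K) ∉ v.asIdeal ∧
        GaloisRep.IsUnramifiedAt v (W.torsionGaloisModule ((p ^ k : ℕ) : ℤ)) := fun v hv => by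
    have hpv : ((p : ℕ) : 𝓞 K) ∉ v.asIdeal := fun h => hv (hpS v h)
    have hgood : W.HasGoodReductionAt v := by_contra fun h => hv (hbad v h)
    have hpkv : ((p ^ k : ℕ) : 𝓞 K) ∉ v.asIdeal := by
      rw [Nat.cast_pow]
      exact fun h => hpv (v.isPrime.mem_of_pow_mem k h)
    exact ⟨hpkv, X11b.AcSelmer.isUnramifiedAt_torsionGaloisModule W hgood
      (by rw [Int.cast_natCast]; exact hpkv)⟩
  have h𝓚 : SelmerStructure.IsUnramifiedOutside (W.kummerSelmerStructure ((p ^ k : ℕ) : ℤ)) S :=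
    X11b.KummerDuality.kummerSelmerStructure_isUnramifiedOutside W p k S hinf hpS hbad
  exact relIndex_update_bot_update_top_eq_of_localEuler W (p ^ k) e hμ hadd₁ hadd₂ hgal hnondeg inv hperf
    hvan hcomp hS h𝓚 hw₀
    (fun v _ => dualTransported_kummerSelmerStructure_eq W (p ^ k) e hμ hadd₁ hadd₂ hgal halt hnondeg inv hn
      hperf hEP hreal v) hn (hEP w₀)

end KummerCount

/-! ## §5b. The same count in the `kummerStrict` / `kummerRelaxed` spelling of `X11b/KummerRelaxedStructures.lean` -/

section KummerPTSpelling

variable {K : Type} [Field K] [NumberField K] (W : WeierstrassCurve K) [W.IsElliptic] (n : ℕ) [NeZero n]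

omit [W.IsElliptic] [NeZero n] in
/-- `kummerStrict W n {v₀}` is the Kummer structure made strict at `v₀` (`Function.update 𝓚 v₀ ⊥`).
[cite: Howard2004HeegnerKolyvagin, Def. 2.1.1 (arXiv:1202.6340 p. 5)] -/
theorem kummerStrict_singleton_eq_update (v₀ : Place K) :
    X11b.KummerPT.kummerStrict W n {v₀} = Function.update (W.kummerSelmerStructure (n : ℤ)) v₀ ⊥ := by
  funext v
  by_cases hv : v = v₀
  · subst hv
    rw [X11b.KummerPT.kummerStrict_of_mem W n {v} (Finset.mem_singleton_self v), Function.update_self]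
  · rw [X11b.KummerPT.kummerStrict_of_not_mem W n {v₀} (fun h => hv (Finset.mem_singleton.mp h)),
      Function.update_of_ne hv]

omit [W.IsElliptic] [NeZero n] in
/-- `kummerRelaxed W n {v₀}` is the Kummer structure relaxed at `v₀` (`Function.update 𝓚 v₀ ⊤`); its
Selmer group is `kummerOutside W n {v₀}` (`X11b.KummerPT.selmerGroup_kummerRelaxed`).
[cite: MilneADT2006, Ch. I §6, (6.5) and Lemma 6.15] -/
theorem kummerRelaxed_singleton_eq_update (v₀ : Place K) :
    X11b.KummerPT.kummerRelaxed W n {v₀} = Function.update (W.kummerSelmerStructure (n : ℤ)) v₀ ⊤ := by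
  funext v
  by_cases hv : v = v₀
  · subst hv
    rw [X11b.KummerPT.kummerRelaxed_of_mem W n {v} (Finset.mem_singleton_self v), Function.update_self]
  · rw [X11b.KummerPT.kummerRelaxed_of_not_mem W n {v₀} (fun h => hv (Finset.mem_singleton.mp h)),
      Function.update_of_ne hv]

/-- **The Kummer count in the `kummerStrict`/`kummerRelaxed` spelling**:
`[H¹_{kummerRelaxed {v₀}}(K, E[n]) : H¹_{kummerStrict {v₀}}(K, E[n])] = #E(K_{v₀})[n] · #(𝓞_{v₀}/n)`
(`n` a prime power, `v₀` finite; hypotheses as in `relIndex_kummer_update_bot_update_top_eq`).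
The relaxed Selmer group is `kummerOutside W n {v₀}` (`X11b.KummerPT.selmerGroup_kummerRelaxed`).
[cite: MilneADT2006, Ch. I, Thm. 2.8, Cor. 3.4, Thm. 4.10 and Lemma 6.15]
[cite: Howard2004HeegnerKolyvagin, Thm. 2.1.11 (arXiv:1202.6340 p. 6)] -/
theorem relIndex_kummerStrict_kummerRelaxed_singleton_eq (hn : IsPrimePow n) (inv : LocalInvariants K n)
    (hperf : inv.IsPerfect) (hvan : inv.SumLocalTermEqZero) (hcomp : inv.SelmerComplement)
    (hEP : ∀ v : HeightOneSpectrum (𝓞 K), localEulerPoincareCharacteristic (v.adicCompletion K))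
    (hreal : ∀ w : InfinitePlace K, w.IsReal → Injective (inv (Sum.inl w)))
    (w₀ : HeightOneSpectrum (𝓞 K)) :
    (X11b.KummerPT.kummerStrict W n {(Sum.inr w₀ : Place K)}).selmerGroup.relIndex
        (X11b.KummerPT.kummerRelaxed W n {(Sum.inr w₀ : Place K)}).selmerGroup =
      Nat.card (nsmulAddMonoidHom n : (W.baseChange (w₀.adicCompletion K)).toAffine.Point →+ _).ker *
        Nat.card (w₀.adicCompletionIntegers K ⧸ Ideal.span {(n : w₀.adicCompletionIntegers K)}) := by
  rw [kummerStrict_singleton_eq_update, kummerRelaxed_singleton_eq_update]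
  exact relIndex_kummer_update_bot_update_top_eq W n hn inv hperf hvan hcomp hEP hreal w₀

end KummerPTSpelling

/-! ## §6. `K = ℚ`, `n = 2`, `v₀ = 2`: `[relaxed : strict] = 2 · #E(ℚ₂)[2]` — "a − b = 1 + e" -/

section RatTwo

variable (W : WeierstrassCurve ℚ) [W.IsElliptic]

/-- **O1 / REFUTER-O1 §19 D5 in the kernel ("`a − b = 1 + e`").**  For an elliptic curve `E/ℚ`, the
place `v₂` of `ℚ` above `2`, and a family `inv` of local invariant maps at level `2` with the three
Poitou–Tate properties of the tree's named fact `poitouTate_selmerStructure_duality ℚ` and injective at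
the real place (`hreal`; `Br(ℝ)[2] = ℤ/2` — a HYPOTHESIS, not in the tree's fact), GIVEN Tate's local
Euler–Poincaré characteristic at the finite places (`hEP`):

  `[H¹_{𝓚^{2}}(ℚ, E[2]) : H¹_{𝓚_{2}}(ℚ, E[2])] = 2 · #E(ℚ₂)[2]`,

where `𝓚` is the Kummer (`2`-descent) Selmer structure, `𝓚^{2}` / `𝓚_{2}` its relaxed / strict
modification at `v₂` (Kummer condition at every other place, the real place included), and
`E(ℚ₂)[2]` is the `2`-torsion of `E` over the completion `ℚ_{v₂}` (`v₂.adicCompletion ℚ`).  In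
`𝔽₂`-dimensions, with `a = dim H¹_{𝓚^{2}}`, `b = dim H¹_{𝓚_{2}}`, `e = dim E(ℚ₂)[2] ∈ {0, 1, 2}`:
**`a − b = 1 + e`** — REFUTER-O1 §19 D5's count (local Euler characteristic at `2` gives `e + 2`, the
real place `−1`, other places `0`) obtained here WITHOUT any archimedean Euler-characteristic factor:
in the relative count every place `≠ 2` cancels.  The solitaire's transverse conditions at auxiliary
Kolyvagin primes are covered by the parent file's abstract self-duality hypothesis `hsd`, not by this
corollary.  `#(ℤ₂/2ℤ₂) = 2` is n1011's `GaloisImage.natCard_quot_adicCompletionIntegers_of_prime_mem`.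
CONDITIONAL on the stated hypotheses; EVIDENCE-neutral; nothing booked; O1 OPEN.
[cite: MilneADT2006, Ch. I, Thm. 2.8, Thm. 2.13, Cor. 3.4, Thm. 4.10 and Lemma 6.15]
[cite: Howard2004HeegnerKolyvagin, Thm. 2.1.11 (arXiv:1202.6340 p. 6)] -/
theorem relIndex_kummer_update_bot_update_top_eq_two_mul (inv : LocalInvariants ℚ 2)
    (hperf : inv.IsPerfect) (hvan : inv.SumLocalTermEqZero) (hcomp : inv.SelmerComplement)
    (hEP : ∀ v : HeightOneSpectrum (𝓞 ℚ), localEulerPoincareCharacteristic (v.adicCompletion ℚ))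
    (hreal : ∀ w : InfinitePlace ℚ, w.IsReal → Injective (inv (Sum.inl w)))
    {v₂ : HeightOneSpectrum (𝓞 ℚ)} (hv₂ : ((2 : ℕ) : 𝓞 ℚ) ∈ v₂.asIdeal) :
    (SelmerStructure.selmerGroup (Function.update (W.kummerSelmerStructure ((2 : ℕ) : ℤ))
          (Sum.inr v₂) ⊥ : SelmerStructure (W.torsionGaloisModule ((2 : ℕ) : ℤ)))).relIndex
        (SelmerStructure.selmerGroup (Function.update (W.kummerSelmerStructure ((2 : ℕ) : ℤ))
          (Sum.inr v₂) ⊤ : SelmerStructure (W.torsionGaloisModule ((2 : ℕ) : ℤ)))) =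
      2 * Nat.card (nsmulAddMonoidHom 2 : (W.baseChange (v₂.adicCompletion ℚ)).toAffine.Point →+ _).ker := by
  rw [relIndex_kummer_update_bot_update_top_eq W 2 Nat.prime_two.isPrimePow inv hperf hvan hcomp hEP hreal v₂,
    GaloisImage.natCard_quot_adicCompletionIntegers_of_prime_mem 2 hv₂, mul_comm]

/-- **"`a − b = 1 + e`" CONDITIONAL ON TWO NAMED FACTS ONLY.**  The relative index does not mention the
local invariant maps, so `inv` and its properties — including the real-place injectivity `hreal` — can be
taken from the tree's cited named fact `poitouTate_selmerStructure_duality_real ℚ` (Milne ADT I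
Ex. 1.6 (c) / Thm. 4.10 (b), Howard Thm. 2.1.11; filed by b2b-bsdres-lit GEN 53, p283639 — ASK L-G18.1
closed): GIVEN that fact (`hPT`) and Tate's local Euler–Poincaré characteristic at the finite places
(`hEP`, the named fact `localEulerPoincareCharacteristic`),
`[H¹_{𝓚^{2}}(ℚ, E[2]) : H¹_{𝓚_{2}}(ℚ, E[2])] = 2 · #E(ℚ_{v₂})[2]` for every elliptic curve `E/ℚ`.
CONDITIONAL on the two named facts (hypotheses, not discharged); EVIDENCE-neutral; nothing booked; O1 OPEN.
[cite: MilneADT2006, Ch. I, Example 1.6 (c) (p. 19), Thm. 2.8, Thm. 2.13 and Thm. 4.10(b) (p. 57)]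
[cite: Howard2004HeegnerKolyvagin, Thm. 2.1.11 (arXiv:1202.6340 p. 6)] -/
theorem relIndex_kummer_update_bot_update_top_eq_two_mul_of_facts
    (hPT : poitouTate_selmerStructure_duality_real ℚ)
    (hEP : ∀ v : HeightOneSpectrum (𝓞 ℚ), localEulerPoincareCharacteristic (v.adicCompletion ℚ))
    {v₂ : HeightOneSpectrum (𝓞 ℚ)} (hv₂ : ((2 : ℕ) : 𝓞 ℚ) ∈ v₂.asIdeal) :
    (SelmerStructure.selmerGroup (Function.update (W.kummerSelmerStructure ((2 : ℕ) : ℤ))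
          (Sum.inr v₂) ⊥ : SelmerStructure (W.torsionGaloisModule ((2 : ℕ) : ℤ)))).relIndex
        (SelmerStructure.selmerGroup (Function.update (W.kummerSelmerStructure ((2 : ℕ) : ℤ))
          (Sum.inr v₂) ⊤ : SelmerStructure (W.torsionGaloisModule ((2 : ℕ) : ℤ)))) =
      2 * Nat.card (nsmulAddMonoidHom 2 : (W.baseChange (v₂.adicCompletion ℚ)).toAffine.Point →+ _).ker := by
  haveI : NeZero (2 : ℕ) := ⟨two_ne_zero⟩
  obtain ⟨inv, hperf, hvan, -, hcomp, hreal⟩ := hPT 2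
  exact relIndex_kummer_update_bot_update_top_eq_two_mul W inv hperf hvan hcomp hEP hreal hv₂

end RatTwo

end Summit.BirchSwinnertonDyer.Rank1Residual.X5.SelfDualCount

end
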